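import Summits.BirchSwinnertonDyer.Rank1Residual.Additive.PotMultUnitRowCoeffCert
import Summits.BirchSwinnertonDyer.Rank1Residual.Additive.ChiBranchRatLowerDvdMultOddEnds
import Summits.BirchSwinnertonDyer.Rank1Residual.Additive.ChiBranchRatLowerDvdMultEnds
import HarnessLib

/-!
# Unit-row discharge on the REDUCIBLE potentially multiplicative rows (X3♯(M)): the (M) unit
# coefficient is FREE on the unit rows, Wuthrich's printed half ALONE gives the one-sided nodes
# `ChiBranchRatLowerDvdMult[Odd]At`, hence the rational branch main conjecture of the multiplicative
# twist and `BSD(E,p)` for `r_an = 0` UNIT rows with NO typed input and NO image hypothesis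
# (cell `b2b-bsdres`, team n1011, seat n1011-p06 gen 2, OWNERS row T-N10R, phase 4, X3♯(M) unit rows)

HONEST FRAMING (cell `b2b-bsdres`, run/shared/lean/b2b/bsd-rank1-residual/, verbatim in every
file): the goal of the cell is to DELETE the COMBINATION-SHAPED residual classes of the
Birch–Swinnerton-Dyer formula for ALL analytic-rank `≤ 1` elliptic curves over `ℚ` — "full BSD
formula for every rank `≤ 1` curve in class `C`" assembled STRICTLY from published theorems — so
that the rank-`≤ 1` remainder becomes exactly the CONSTRUCTION-SHAPED classes, which are TYPED
(missing-input `Prop`s), NOT attempted. This is not "finishing BSD". Team n1011 (X4 ∧ `p = 3` / the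
additive block, §I items N10 / N11): research routes; prove what is provable now; no claim beyond
the stated classes; X3♯(M) stays CONSTRUCTION-SHAPED as a class; labels / census / located gap
UNCHANGED; nothing is booked. Theorems only (no definition, no named fact minted; the Literature
inputs are explicit binders: `hWu` = Wuthrich 2014 Thm. 16 in its half-eigenspace reading, Delbourgo
1998 Prop. 4 / §2.2, Pal 2012 (even rows), GZK, modularity).

## What and why

(M) twin of `ChiBranchRatLowerDvdUnitRowsX3.lean`, X3 twin of `ChiBranchRatLowerDvdUnitRows.lean` §2 /
`ChiBranchRatLowerDvdUnitRowsMult.lean` (same seat). §0 = `PotMultUnitRowCoeffCert.lean` (same seat): on a UNIT row (`L(E,1) = q·Ω_E`, `q ≠ 0`,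
`ord_p q = 0`) the constant term of the Néron-normalised branch `ϖ · L_p^∓(f♭, a_p, ω^{(p−1)/2}, T)` of
the MULTIPLICATIVE twist is a `p`-adic unit (`constantCoeff_padicLFunction{Minus,Plus}BranchMult_half`:
`ϖ·a_p⁻¹·S^∓`, `a_p = ±1`, `p ∣ N`; `ϖ·S⁻ = c_∞(E)·q` / `ϖ·S⁺ = q` by the signed Birch–Gauss–Pal
identities, PROVED), so the (M) certificates `Mult[Odd]BranchUnitCoeffCert W p` are FREE (index `0`),
X3♯(M) and X4(M) alike. §1–§2: on the REDUCIBLE rows Wuthrich's half is INTEGRAL in the tree's reading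
(`exists_mem_charIdeal_map_eq_unit_mul_{minus,plus}BranchMult_of_wuthrichHalf`: `ι g₁ = u·ϖ L_br`,
`u ∈ ℤ_pˣ`, no image hypothesis), so `u⁻¹ g₁` is a unit of `Λ` and the node
`ChiBranchRatLowerDvdMult[Odd]At W p` holds with `G = u⁻¹ g₁`, `m = n = 0`; the splits (p253723 /
p255444) give the rational branch main conjectures of the multiplicative twist. §3: with the ClassX3M
ends in the tree this is `BSD(E,p)` on X3♯(M), `r_an = 0`, UNIT rows — every `p ≡ 3 (mod 4)` including
`3`, and `p ≡ 1 (mod 4)` with Pal's binder — EVERY hypothesis a printed theorem (binder) or a row datum.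
Nothing booked; no label change; X3♯(M) stays CONSTRUCTION-SHAPED off the unit rows.

References: C. Wuthrich, J. London Math. Soc. 90 (2014) Thm. 16 (p. 397) [Wuthrich2014];
Mazur–Tate–Teitelbaum, Invent. Math. 84 (1986) §I.10 (10.1), §I.13–I.14 [MazurTateTeitelbaum1986Invent];
A. Pal, Proc. AMS (2012) Thm. 3.2 [Pal2012]; D. Delbourgo, Compositio 113 (1998) Prop. 4 (p. 144),
§2.2 Lemma (ii) (p. 139) [Delbourgo1998]; C. Skinner, E. Urban, Invent. Math. 195 (2014) Thm. 3.6.4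
(p. 43) [SkinnerUrban2014]; H. Montgomery, R. Vaughan (2007) Thm. 9.17 [MontgomeryVaughan2007].
-/

noncomputable section

open scoped Classical MatrixGroups ModularForm NumberField

open CongruenceSubgroup WeierstrassCurve NumberField Literature.NumberTheory.EllipticCurves
  Literature.NumberTheory.EllipticCurves.ModularForms
  Literature.NumberTheory.EllipticCurves.Rank1Residual
  Literature.NumberTheory.EllipticCurves.Rank1Residual.Typed
  Literature.NumberTheory.GaloisRepresentations
  IsDedekindDomain

namespace Summit.BirchSwinnertonDyer.Rank1Residual.Additive

/-! ### §1 Reducible (M) rows, odd branch (`p ≡ 3 (mod 4)`): the node and the rational MC on the unit rows -/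

section MultOdd

variable {W : WeierstrassCurve ℚ} [W.IsElliptic] [W.IsGloballyMinimal] {p : ℕ} [hp : Fact p.Prime]

/-- **UNIT rows, REDUCIBLE `W[p]`, (M) odd branch: Wuthrich's half ALONE gives the one-sided node
`ChiBranchRatLowerDvdMultOddAt W p`** (`W` additive potentially multiplicative at `p ≡ 3 (mod 4)`,
`W[p]` reducible, `L(E,1) = q·Ω_E`, `ord_p q = 0`: `ι g₁ = u·ϖ·L_p⁻`, `u ∈ ℤ_pˣ`, unit constant term
by `norm_constantCoeff_…BranchMult_eq_one_of_unitLValue`, so `(u⁻¹ g₁) = Λ`). No image hypothesis. [cite: Wuthrich2014, Thm. 16 (p. 397)]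
[cite: MazurTateTeitelbaum1986Invent, §I.13–I.14] -/
theorem chiBranchRatLowerDvdMultOddAt_of_wuthrichHalf_of_unitLValue
    (hWu : Wuthrich2014.thm16_halfEigenCharIdeal_dvd_cyclotomicPrime)
    (hmod : hasEntireLFunction_rat) (hpm : AdditivePotMult.PotMult W p) (hredW : Red W p)
    {q : ℚ} (hq : W.entireLFunction 1 = (q : ℂ) * (W.realPeriodRat : ℂ)) (hq0 : q ≠ 0)
    (hv : padicValRat p q = 0) :
    ChiBranchRatLowerDvdMultOddAt W p := by
  intro V _ _ κ γ N _ f hp3 hCW hV hκ hγ hcv hf ap hap D ϖ hϖ g _hg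
  -- Wuthrich's element
  obtain ⟨-, g₁, -, u, hιg₁⟩ :=
    exists_mem_charIdeal_map_eq_unit_mul_minusBranchMult_of_wuthrichHalf W p hWu hpm hredW V hp3 hCW hκ hγ
      hcv hf hap D ϖ hϖ
  -- `G := u⁻¹ g₁`, `ι G = ϖ L_br`
  have hιG := map_C_unitsInv_mul_eq_C_mul hιg₁
  -- unit constant term on a unit row (`PotMultUnitRowCoeffCert`)
  obtain ⟨C, hC⟩ := hCW
  have h1 := norm_constantCoeff_minusBranchMult_eq_one_of_unitLValue hmod hp3 hpm.1 V C hC hV hf hap ϖ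
    hϖ hq hq0 hv
  refine ⟨PowerSeries.C ((u⁻¹ : ℤ_[p]ˣ) : ℤ_[p]) * g₁, 0, 0, ?_, ?_⟩
  · rw [span_singleton_eq_top_of_map_eq_of_norm_constantCoeff_eq_one p hιG h1]
    exact Submodule.mem_top
  · rw [pow_zero, map_one, one_mul, hιG]

/-- **UNIT rows, REDUCIBLE `W[p]`, (M) odd branch: the rational `ω^{(p−1)/2}`-branch main conjecture
of the multiplicative twist `ChiBranchRatCharEqMultOddAt W p` is a THEOREM from Wuthrich's half** (node
+ split `chiBranchRatCharEqMultOddAt_of_wuthrichHalf_of_ratLowerDvd`). No image hypothesis, no certificate.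
[cite: Wuthrich2014, Thm. 16 (p. 397)] [cite: SkinnerUrban2014, Thm. 3.6.4, proof (p. 43)] -/
theorem chiBranchRatCharEqMultOddAt_of_wuthrichHalf_of_unitLValue
    (hWu : Wuthrich2014.thm16_halfEigenCharIdeal_dvd_cyclotomicPrime)
    (hmod : hasEntireLFunction_rat) (hpm : AdditivePotMult.PotMult W p) (hredW : Red W p)
    {q : ℚ} (hq : W.entireLFunction 1 = (q : ℂ) * (W.realPeriodRat : ℂ)) (hq0 : q ≠ 0)
    (hv : padicValRat p q = 0) :
    ChiBranchRatCharEqMultOddAt W p :=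
  chiBranchRatCharEqMultOddAt_of_wuthrichHalf_of_ratLowerDvd hWu hpm hredW
    (chiBranchRatLowerDvdMultOddAt_of_wuthrichHalf_of_unitLValue hWu hmod hpm hredW hq hq0 hv)

/-- **X3♯(M) (`Red W p ∧ Addv W p ∧ PotMult W p`, `p` odd), `p ≡ 3 (mod 4)`, UNIT rows: the one-sided
node `ChiBranchRatLowerDvdMultOddAt W p` is a THEOREM** (Wuthrich's half; no image hypothesis, no
certificate). [cite: Wuthrich2014, Thm. 16 (p. 397)] [cite: MazurTateTeitelbaum1986Invent, §I.13–I.14] -/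
theorem _root_.Summit.BirchSwinnertonDyer.Rank1Residual.AdditivePotMult.ClassX3M.chiBranchRatLowerDvdMultOddAt_of_unitLValue
    (hWu : Wuthrich2014.thm16_halfEigenCharIdeal_dvd_cyclotomicPrime)
    (hmod : hasEntireLFunction_rat) (hX : AdditivePotMult.ClassX3M W p)
    {q : ℚ} (hq : W.entireLFunction 1 = (q : ℂ) * (W.realPeriodRat : ℂ)) (hq0 : q ≠ 0)
    (hv : padicValRat p q = 0) :
    ChiBranchRatLowerDvdMultOddAt W p :=
  chiBranchRatLowerDvdMultOddAt_of_wuthrichHalf_of_unitLValue hWu hmod hX.potMult hX.classX3.1 hq hq0 hv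

/-- **X3♯(M), `p ≡ 3 (mod 4)`, UNIT rows: the rational odd-branch main conjecture of the multiplicative
twist `ChiBranchRatCharEqMultOddAt W p` is a THEOREM** (no image hypothesis, no certificate).
[cite: Wuthrich2014, Thm. 16 (p. 397)] [cite: SkinnerUrban2014, Thm. 3.6.4, proof (p. 43)] -/
theorem _root_.Summit.BirchSwinnertonDyer.Rank1Residual.AdditivePotMult.ClassX3M.chiBranchRatCharEqMultOddAt_of_unitLValue
    (hWu : Wuthrich2014.thm16_halfEigenCharIdeal_dvd_cyclotomicPrime)
    (hmod : hasEntireLFunction_rat) (hX : AdditivePotMult.ClassX3M W p)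
    {q : ℚ} (hq : W.entireLFunction 1 = (q : ℂ) * (W.realPeriodRat : ℂ)) (hq0 : q ≠ 0)
    (hv : padicValRat p q = 0) :
    ChiBranchRatCharEqMultOddAt W p :=
  hX.chiBranchRatCharEqMultOddAt_of_ratLowerDvd hWu
    (hX.chiBranchRatLowerDvdMultOddAt_of_unitLValue hWu hmod hq hq0 hv)

end MultOdd

/-! ### §2 Reducible (M) rows, even branch (`p ≡ 1 (mod 4)`): the node and the rational MC on the unit rows -/

section MultEven

variable {W : WeierstrassCurve ℚ} [W.IsElliptic] [W.IsGloballyMinimal] {p : ℕ} [hp : Fact p.Prime]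

/-- **UNIT rows, REDUCIBLE `W[p]`, (M) even branch (`p ≡ 1 (mod 4)`): Wuthrich's half ALONE gives the
one-sided node `ChiBranchRatLowerDvdMultAt W p`** (`ι g₁ = u·ϖ·L_p⁺(f♭, a_p, ω^{(p−1)/2}, T)` with unit
constant term by `norm_constantCoeff_…BranchMult_eq_one_of_unitLValue`, so `(u⁻¹ g₁) = Λ`). No image hypothesis. [cite: Wuthrich2014, Thm. 16 (p. 397)]
[cite: MazurTateTeitelbaum1986Invent, §I.10, §I.13–I.14] [cite: Pal2012, Thm. 3.2] -/
theorem chiBranchRatLowerDvdMultAt_of_wuthrichHalf_of_unitLValue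
    (hWu : Wuthrich2014.thm16_halfEigenCharIdeal_dvd_cyclotomicPrime)
    (hmod : hasEntireLFunction_rat) (hpm : AdditivePotMult.PotMult W p) (hredW : Red W p)
    {q : ℚ} (hq : W.entireLFunction 1 = (q : ℂ) * (W.realPeriodRat : ℂ)) (hq0 : q ≠ 0)
    (hv : padicValRat p q = 0) :
    ChiBranchRatLowerDvdMultAt W p := by
  intro V _ _ κ γ N _ f hp1 hCW hV hκ hγ hcv hf ap hap D ϖ hϖ g _hg
  -- Wuthrich's element
  obtain ⟨-, g₁, -, u, hιg₁⟩ :=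
    exists_mem_charIdeal_map_eq_unit_mul_plusBranchMult_of_wuthrichHalf W p hWu hpm hredW V hp1 hCW hκ hγ
      hcv hf hap D ϖ hϖ
  -- `G := u⁻¹ g₁`, `ι G = ϖ L_br`
  have hιG := map_C_unitsInv_mul_eq_C_mul hιg₁
  obtain ⟨C, hC⟩ := hCW
  have h1 := norm_constantCoeff_plusBranchMult_eq_one_of_unitLValue hmod hp1 hpm.1 V C hC hV hf hap ϖ
    hϖ hq hq0 hv
  refine ⟨PowerSeries.C ((u⁻¹ : ℤ_[p]ˣ) : ℤ_[p]) * g₁, 0, 0, ?_, ?_⟩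
  · rw [span_singleton_eq_top_of_map_eq_of_norm_constantCoeff_eq_one p hιG h1]
    exact Submodule.mem_top
  · rw [pow_zero, map_one, one_mul, hιG]

/-- **UNIT rows, REDUCIBLE `W[p]`, (M) even branch: the rational `ω^{(p−1)/2}`-branch main conjecture
of the multiplicative twist `ChiBranchRatCharEqMultAt W p` is a THEOREM from Wuthrich's half** (node +
split `chiBranchRatCharEqMultAt_of_wuthrichHalf_of_ratLowerDvd`). No image hypothesis, no certificate.
[cite: Wuthrich2014, Thm. 16 (p. 397)] [cite: SkinnerUrban2014, Thm. 3.6.4, proof (p. 43)] -/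
theorem chiBranchRatCharEqMultAt_of_wuthrichHalf_of_unitLValue
    (hWu : Wuthrich2014.thm16_halfEigenCharIdeal_dvd_cyclotomicPrime)
    (hmod : hasEntireLFunction_rat) (hpm : AdditivePotMult.PotMult W p) (hredW : Red W p)
    {q : ℚ} (hq : W.entireLFunction 1 = (q : ℂ) * (W.realPeriodRat : ℂ)) (hq0 : q ≠ 0)
    (hv : padicValRat p q = 0) :
    ChiBranchRatCharEqMultAt W p :=
  chiBranchRatCharEqMultAt_of_wuthrichHalf_of_ratLowerDvd hWu hpm hredW
    (chiBranchRatLowerDvdMultAt_of_wuthrichHalf_of_unitLValue hWu hmod hpm hredW hq hq0 hv)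

/-- **X3♯(M), `p ≡ 1 (mod 4)`, UNIT rows: the one-sided node `ChiBranchRatLowerDvdMultAt W p` is a
THEOREM** (Wuthrich's half; no image hypothesis, no certificate).
[cite: Wuthrich2014, Thm. 16 (p. 397)] [cite: MazurTateTeitelbaum1986Invent, §I.13–I.14] -/
theorem _root_.Summit.BirchSwinnertonDyer.Rank1Residual.AdditivePotMult.ClassX3M.chiBranchRatLowerDvdMultAt_of_unitLValue
    (hWu : Wuthrich2014.thm16_halfEigenCharIdeal_dvd_cyclotomicPrime)
    (hmod : hasEntireLFunction_rat) (hX : AdditivePotMult.ClassX3M W p)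
    {q : ℚ} (hq : W.entireLFunction 1 = (q : ℂ) * (W.realPeriodRat : ℂ)) (hq0 : q ≠ 0)
    (hv : padicValRat p q = 0) :
    ChiBranchRatLowerDvdMultAt W p :=
  chiBranchRatLowerDvdMultAt_of_wuthrichHalf_of_unitLValue hWu hmod hX.potMult hX.classX3.1 hq hq0 hv

/-- **X3♯(M), `p ≡ 1 (mod 4)`, UNIT rows: the rational even-branch main conjecture of the
multiplicative twist `ChiBranchRatCharEqMultAt W p` is a THEOREM** (no image hypothesis, no certificate).
[cite: Wuthrich2014, Thm. 16 (p. 397)] [cite: SkinnerUrban2014, Thm. 3.6.4, proof (p. 43)] -/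
theorem _root_.Summit.BirchSwinnertonDyer.Rank1Residual.AdditivePotMult.ClassX3M.chiBranchRatCharEqMultAt_of_unitLValue
    (hWu : Wuthrich2014.thm16_halfEigenCharIdeal_dvd_cyclotomicPrime)
    (hmod : hasEntireLFunction_rat) (hX : AdditivePotMult.ClassX3M W p)
    {q : ℚ} (hq : W.entireLFunction 1 = (q : ℂ) * (W.realPeriodRat : ℂ)) (hq0 : q ≠ 0)
    (hv : padicValRat p q = 0) :
    ChiBranchRatCharEqMultAt W p :=
  hX.chiBranchRatCharEqMultAt_of_ratLowerDvd hWu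
    (hX.chiBranchRatLowerDvdMultAt_of_unitLValue hWu hmod hq hq0 hv)

end MultEven

/-! ### §3 X3♯(M) ends on the unit rows: `BSD(E,p)` with every hypothesis printed or a row datum -/

section Ends

variable {W : WeierstrassCurve ℚ} [W.IsElliptic] [W.IsGloballyMinimal] {p : ℕ} [hp : Fact p.Prime]

/-- **X3♯(M), `p ≡ 3 (mod 4)` (`p = 3` INCLUDED), `r_an = 0`, UNIT rows (`L(E,1) = q·Ω_E`, `ord_p q = 0`):
the LOWER half `ord_p #Ш_an ≤ ord_p #Ш` with NO typed input and NO image hypothesis** — node (§1) and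
certificate (`PotMultUnitRowCoeffCert`) free on the unit rows, then p253723's
`ClassX3M.missingLowerBoundAt_rankZero_of_ratLowerDvdMultOdd_of_unitCoeff` (Delbourgo 1998 Prop. 4 +
§2.2 Lemma (ii) `hDelX`, exact on (M); GZK; modularity). Nothing booked.
[cite: Wuthrich2014, Thm. 16 (p. 397)] [cite: Delbourgo1998, Prop. 4 (p. 144), §2.2 Lemma (ii) (p. 139)]
[cite: Miller2011LMS, Def. 1.1] -/
theorem _root_.Summit.BirchSwinnertonDyer.Rank1Residual.AdditivePotMult.ClassX3M.missingLowerBoundAt_rankZero_of_wuthrichHalf_of_unitLValue_odd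
    (hWu : Wuthrich2014.thm16_halfEigenCharIdeal_dvd_cyclotomicPrime)
    (hDelX : Delbourgo1998.prop4_rankZero_constantCoeff_eq_unit_mul_of_potMult)
    (hGZK : rank_eq_analyticRank_of_analyticRank_le_one) (hmod : hasEntireLFunction_rat)
    (hmodD : nonempty_modularParametrizationData)
    (hX : AdditivePotMult.ClassX3M W p) (hp4 : p % 4 = 3) (hr : W.analyticRank = 0)
    {q : ℚ} (hq : W.entireLFunction 1 = (q : ℂ) * (W.realPeriodRat : ℂ)) (hq0 : q ≠ 0)
    (hv : padicValRat p q = 0) :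
    MissingLowerBoundAt W p :=
  hX.missingLowerBoundAt_rankZero_of_ratLowerDvdMultOdd_of_unitCoeff hWu hDelX hGZK hmod hmodD hp4 hr
    (hX.chiBranchRatLowerDvdMultOddAt_of_unitLValue hWu hmod hq hq0 hv)
    (multOddBranchUnitCoeffCert_of_unitLValue hmod hp4 hX.potMult.1 hq hq0 hv)

/-- **X3♯(M), `p ≡ 3 (mod 4)` (`p = 3` INCLUDED), `r_an = 0`, UNIT rows: `BSD(E,p)` with NO typed input
and NO image hypothesis** — every hypothesis is a PRINTED theorem carried as a binder (Wuthrich 2014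
Thm. 16 `hWu`: node (§1), upgrade to the rational equality, AND the upper half; Delbourgo 1998 Prop. 4 /
§2.2 `hDelX`, `hDel`; GZK; modularity) or a ROW DATUM (`ClassX3M W p`, `r_an = 0`, `L(E,1) = q·Ω_E`
with `ord_p q = 0`). Composition of §1 + the free certificate with p253723's
`ClassX3M.bsdp_rankZero_of_ratLowerDvdMultOdd_of_unitCoeff`. `E[p]` reducible: `p`-torsion and the
LOWER half are live on these rows. Nothing booked; X3♯(M) stays CONSTRUCTION-SHAPED off the unit rows.
[cite: Wuthrich2014, Thm. 16 (p. 397)] [cite: SkinnerUrban2014, Cor. 3.6.2 (p. 42) (shape only)]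
[cite: Delbourgo1998, Prop. 4 (p. 144), §2.2 Lemma (ii) (p. 139)] [cite: Miller2011LMS, §1 and Def. 1.1] -/
theorem _root_.Summit.BirchSwinnertonDyer.Rank1Residual.AdditivePotMult.ClassX3M.bsdp_rankZero_of_wuthrichHalf_of_unitLValue_odd
    (hWu : Wuthrich2014.thm16_halfEigenCharIdeal_dvd_cyclotomicPrime)
    (hDelX : Delbourgo1998.prop4_rankZero_constantCoeff_eq_unit_mul_of_potMult)
    (hDel : Delbourgo1998.prop4_rankZero_pow_dvd_constantCoeff)
    (hGZK : rank_eq_analyticRank_of_analyticRank_le_one) (hmod : hasEntireLFunction_rat)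
    (hmodD : nonempty_modularParametrizationData)
    (hX : AdditivePotMult.ClassX3M W p) (hp4 : p % 4 = 3) (hr : W.analyticRank = 0)
    {q : ℚ} (hq : W.entireLFunction 1 = (q : ℂ) * (W.realPeriodRat : ℂ)) (hq0 : q ≠ 0)
    (hv : padicValRat p q = 0) :
    BSDp W p :=
  hX.bsdp_rankZero_of_ratLowerDvdMultOdd_of_unitCoeff hWu hDelX hDel hGZK hmod hmodD hp4 hr
    (hX.chiBranchRatLowerDvdMultOddAt_of_unitLValue hWu hmod hq hq0 hv)
    (multOddBranchUnitCoeffCert_of_unitLValue hmod hp4 hX.potMult.1 hq hq0 hv)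

/-- **X3♯(M), `p ≡ 1 (mod 4)`, `r_an = 0`, UNIT rows: the LOWER half `ord_p #Ш_an ≤ ord_p #Ш` with NO
typed input and NO image hypothesis** (node §2 + free certificate + p255444's
`ClassX3M.missingLowerBoundAt_rankZero_of_ratLowerDvdMult_of_unitCoeff`: Delbourgo 1998 `hDelX`, Pal
`hPal`, GZK, modularity). Nothing booked. [cite: Wuthrich2014, Thm. 16 (p. 397)]
[cite: Delbourgo1998, Prop. 4 (p. 144), §2.2 Lemma (ii) (p. 139)] [cite: Pal2012, Thm. 3.2]
[cite: Miller2011LMS, Def. 1.1] -/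
theorem _root_.Summit.BirchSwinnertonDyer.Rank1Residual.AdditivePotMult.ClassX3M.missingLowerBoundAt_rankZero_of_wuthrichHalf_of_unitLValue_even
    (hWu : Wuthrich2014.thm16_halfEigenCharIdeal_dvd_cyclotomicPrime)
    (hDelX : Delbourgo1998.prop4_rankZero_constantCoeff_eq_unit_mul_of_potMult)
    (hPal : Pal2012.thm32_sqrt_mul_realPeriodRat_twist_eq_of_prime_one_mod_four)
    (hGZK : rank_eq_analyticRank_of_analyticRank_le_one) (hmod : hasEntireLFunction_rat)
    (hmodD : nonempty_modularParametrizationData)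
    (hX : AdditivePotMult.ClassX3M W p) (hp4 : p % 4 = 1) (hr : W.analyticRank = 0)
    {q : ℚ} (hq : W.entireLFunction 1 = (q : ℂ) * (W.realPeriodRat : ℂ)) (hq0 : q ≠ 0)
    (hv : padicValRat p q = 0) :
    MissingLowerBoundAt W p :=
  hX.missingLowerBoundAt_rankZero_of_ratLowerDvdMult_of_unitCoeff hWu hDelX hPal hGZK hmod hmodD hp4 hr
    (hX.chiBranchRatLowerDvdMultAt_of_unitLValue hWu hmod hq hq0 hv)
    (multBranchUnitCoeffCert_of_unitLValue hmod hp4 hX.potMult.1 hq hq0 hv)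

/-- **X3♯(M), `p ≡ 1 (mod 4)`, `r_an = 0`, UNIT rows: `BSD(E,p)` with NO typed input and NO image
hypothesis** (Wuthrich `hWu` thrice; Delbourgo 1998 `hDelX`, `hDel`; Pal `hPal`; GZK; modularity; row
data). Composition of §2 + the free certificate with p255444's `ClassX3M.bsdp_rankZero_of_ratLowerDvdMult_of_unitCoeff`.
Nothing booked; X3♯(M) stays CONSTRUCTION-SHAPED off the unit rows. [cite: Wuthrich2014, Thm. 16 (p. 397)]
[cite: SkinnerUrban2014, Cor. 3.6.2 (p. 42) (shape only)] [cite: Delbourgo1998, Prop. 4 (p. 144)]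
[cite: Pal2012, Thm. 3.2] [cite: Miller2011LMS, §1 and Def. 1.1] -/
theorem _root_.Summit.BirchSwinnertonDyer.Rank1Residual.AdditivePotMult.ClassX3M.bsdp_rankZero_of_wuthrichHalf_of_unitLValue_even
    (hWu : Wuthrich2014.thm16_halfEigenCharIdeal_dvd_cyclotomicPrime)
    (hDelX : Delbourgo1998.prop4_rankZero_constantCoeff_eq_unit_mul_of_potMult)
    (hDel : Delbourgo1998.prop4_rankZero_pow_dvd_constantCoeff)
    (hPal : Pal2012.thm32_sqrt_mul_realPeriodRat_twist_eq_of_prime_one_mod_four)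
    (hGZK : rank_eq_analyticRank_of_analyticRank_le_one) (hmod : hasEntireLFunction_rat)
    (hmodD : nonempty_modularParametrizationData)
    (hX : AdditivePotMult.ClassX3M W p) (hp4 : p % 4 = 1) (hr : W.analyticRank = 0)
    {q : ℚ} (hq : W.entireLFunction 1 = (q : ℂ) * (W.realPeriodRat : ℂ)) (hq0 : q ≠ 0)
    (hv : padicValRat p q = 0) :
    BSDp W p :=
  hX.bsdp_rankZero_of_ratLowerDvdMult_of_unitCoeff hWu hDelX hDel hPal hGZK hmod hmodD hp4 hr
    (hX.chiBranchRatLowerDvdMultAt_of_unitLValue hWu hmod hq hq0 hv)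
    (multBranchUnitCoeffCert_of_unitLValue hmod hp4 hX.potMult.1 hq hq0 hv)

end Ends

end Summit.BirchSwinnertonDyer.Rank1Residual.Additive

end
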